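import Mathlib
import Summits.ValiantsHypothesis.ValiantsHypothesis.Theses.ElementaryWordLength

/-!
# Sketch — crux WordLengthQP (stmt-ValiantsHypothesis-6623), ideator 1, round 1

First-lemma signatures for the crux idea card `eps-order-ladder`
(border width-2 = this crux's width-3 words minus one register; the ε-ORDER of the
approximation is the new resource axis; rung 0 = Allender–Wang).
Nothing here is proved; every `sorry` is a statement offered to crux-plan.
-/

namespace Summit.ValiantsHypothesis.ValiantsHypothesis.Cruxes.WordLengthQP.EpsOrderLadder

open Literature.Computability.AlgebraicComplexity
open Summit.ValiantsHypothesis.ValiantsHypothesis.Theses.ElementaryWordLength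

noncomputable section

/-- The coefficient ring `ℂ[ε]` of border (approximate) programs, `ε = Polynomial.X`. -/
abbrev Eps : Type := Polynomial ℂ

/-- An entry of a width-2 layer is an S-AFFINE label over `ℂ[ε]`: a constant `b(ε)` or
`a(ε)·x_v + b(ε)` for ONE variable `x_v` (Allender–Wang / BIZ18 §5 label types R ⊂ S ⊂ gen;
the crux's letters `E_ij(λ·x_kl)`, `E_ij(λ)` are S-type). -/
def IsSAffine {σ : Type*} (e : MvPolynomial σ Eps) : Prop :=
  (∃ b : Eps, e = MvPolynomial.C b) ∨
    ∃ (a b : Eps) (v : σ), e = MvPolynomial.C a * MvPolynomial.X v + MvPolynomial.C b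

/-- `BW2With f q L`: `f` is the `ε^q`-LEADING coefficient of the `(0,0)` entry of a product of at
most `L` width-2 layers with S-affine entries over `ℂ[ε][x]`:
`(∏ M_t)₀₀ = ε^q · f + ε^(q+1) · G`.  `q` = the ε-order (pole budget after clearing
denominators), `L` = the length.  `q = 0` is EXACT width-2 computability (Allender–Wang). -/
def BW2With {σ : Type*} (f : MvPolynomial σ ℂ) (q L : ℕ) : Prop :=
  ∃ M : List (Matrix (Fin 2) (Fin 2) (MvPolynomial σ Eps)),
    M.length ≤ L ∧ (∀ A ∈ M, ∀ i j, IsSAffine (A i j)) ∧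
    ∃ G : MvPolynomial σ Eps,
      M.prod 0 0 =
        MvPolynomial.C (Polynomial.X ^ q : Eps) * MvPolynomial.map (algebraMap ℂ Eps) f +
          MvPolynomial.C (Polynomial.X ^ (q + 1) : Eps) * G

/-- The permanent instance. -/
def BW2 (n q L : ℕ) : Prop := BW2With (perPoly (Fin n) ℂ) q L

/-- THE LADDER (C⁺ of the card): for every quasi-polynomial budget, eventually `per_n` is not
the `ε^q`-leading coefficient of any width-2 S-program of ε-order `q` and length `L` within the
budget.  Claimed EQUIVALENT to `WordLengthQP` (below, modulo BIZ18 Prop. 3.5 + Brent). -/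
def EpsOrderLadder : Prop :=
  ∀ c : ℕ, ∃ n : ℕ, ∀ q L : ℕ,
    q ≤ 2 ^ ((Nat.log 2 n + c) ^ c) → L ≤ 2 ^ ((Nat.log 2 n + c) ^ c) → ¬ BW2 n q L

/-- Rung `q` of the ladder (a RESTRICTED model for fixed `q`; rung 0 = exact width 2, settled by
Allender–Wang for `n ≥ n₀`; rung 1 = "order-1 cascades" = the first open rung). -/
def EpsOrderRung (q : ℕ) : Prop :=
  ∀ c : ℕ, ∃ n : ℕ, ∀ L : ℕ, L ≤ 2 ^ ((Nat.log 2 n + c) ^ c) → ¬ BW2 n q L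

/-- Rungs are consequences of the ladder (pure bookkeeping: `q ≤ 2^((log n + c)^c)` eventually). -/
theorem epsOrderRung_of_ladder (h : EpsOrderLadder) (q : ℕ) : EpsOrderRung q := by
  sorry

/-- BIZ18 Prop. 3.5 (Bringmann–Ikenmeyer–Zuiddam, J. ACM 65 (2018) / CCC 2017, arXiv:1702.05328,
Prop. 3.5 with denominators cleared): a fan-in-2 formula of depth `d` for `f` gives a product of
`≤ 45·9^d` primitive Q-matrices over `ℂ(ε)` in `Q(f) + O(ε)`; the gadgets carry poles `ε^{-3^j}`,
so after clearing, `f` is the `ε^q`-leading `(0,0)` coefficient with `q ≤ 45·27^d`.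
Named-fact SHAPE only (to be vendored under Literature/…; unproved in tree). -/
def BIZ2018_prop35 : Prop :=
  ∀ {σ : Type} [Fintype σ] (P : ArithCircuit ℂ σ) (f : MvPolynomial σ ℂ),
    P.IsFormula → P.IsFanInTwo → P.Computes f →
      ∃ q, q ≤ 45 * 27 ^ P.depth ∧ BW2With f q (45 * 9 ^ P.depth)

/-- Brent / BCS97 (21.35) in the shape needed: formulas balance to depth `O(log size)`.
Named-fact SHAPE only (constant 4 is generous: D(f) ≤ (2/log₂φ)·log₂ E(f) + O(1)). -/
def BrentBalancing : Prop :=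
  ∀ {σ : Type} [Fintype σ] (f : MvPolynomial σ ℂ),
    ∃ P : ArithCircuit ℂ σ, P.IsFormula ∧ P.IsFanInTwo ∧ P.Computes f ∧
      P.depth ≤ 4 * Nat.log 2 (formulaComplexity f + 1) + 4

/-- TRUNCATION DE-BORDERING (provable now, support-sized): reading a `BW2` program modulo
`ε^(q+1)` is an EXACT ABP of width `2(q+1)` (block-Toeplitz), hence a fan-in-2 formula of size
`L^{O(log q)}` by divide and conquer on the matrix product. -/
theorem formulaComplexity_le_of_bw2 {n q L : ℕ} (h : BW2 n q L) :
    formulaComplexity (perPoly (Fin n) ℂ) ≤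
      (n ^ 2 + 2) * (2 * (q + 1) * (L + 1)) ^ (Nat.log 2 (2 * (q + 1)) + 2) := by
  sorry

/-- GLUE, direction used by the route: the ladder implies the crux
(¬X ⇒ qp words ⇒ qp formulas (`WordToFormula`) ⇒ polylog depth (Brent) ⇒ BIZ Prop 3.5 ⇒
`BW2 n q L` with `q, L` quasi-polynomial ⇒ ¬ladder). -/
theorem wordLengthQP_of_epsOrderLadder (hBIZ : BIZ2018_prop35) (hBrent : BrentBalancing)
    (hW2F : WordToFormula) : EpsOrderLadder → WordLengthQP := by
  sorry

/-- GLUE, converse (so the transfer loses nothing at qp scale): the crux implies the ladder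
(`BW2` ⇒ formula of size `L^{O(log q)}` (truncation) ⇒ balanced (Brent) ⇒ word of length
`4^depth` (`BocSimulation`)). -/
theorem epsOrderLadder_of_wordLengthQP (hBrent : BrentBalancing) (hBoc : BocSimulation) :
    WordLengthQP → EpsOrderLadder := by
  sorry

/-- RUNG 0 = Allender–Wang (CC 25 (2016); BIZ18 Thm 5.8/5.9): `x₁x₂ + ⋯ + x₁₅x₁₆` has no exact
width-2 program of ANY length, and it is a projection of `per_{n₀}`; S-programs are closed under
projection.  Offered as the calibration statement of the line (the `n₀` is explicit, ≤ 34). -/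
theorem epsOrderRung_zero : EpsOrderRung 0 := by
  sorry

/-- RUNG 1, normal form (provable now): an ε-order-1 program is a ONE-WAY CASCADE — the target is
`Σ_t (row of the exact width-2 prefix) · A¹_t · (column of the exact width-2 suffix)` over ONE exact
skeleton `A⁰_1 ⋯ A⁰_L` whose own `(0,0)` entry vanishes.  Stated as: order 1 and length `L` give a
decomposition of `per_n` into `≤ 4L` products `u · a · v` with `u, v` entries of exact width-2
S-products of length `≤ L` and `a` S-affine over `ℂ`. -/
theorem rung_one_cascade_normal_form {n L : ℕ} (h : BW2 n 1 L) :
    ∃ (T : ℕ) (u v : Fin T → MvPolynomial (Fin n × Fin n) ℂ) (a : Fin T → MvPolynomial (Fin n × Fin n) ℂ),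
      T ≤ 4 * L ∧
      (∀ t, BW2With (u t) 0 (L + 1) ∧ BW2With (v t) 0 (L + 1) ∧ (a t).totalDegree ≤ 1) ∧
      perPoly (Fin n) ℂ = ∑ t, u t * a t * v t := by
  sorry

/-! ### The word-intrinsic twin: accumulator feedback count

In the crux's own word type a letter `l = (i, j, λ, v)` acts on ROW vectors by `entry j += (λ·x_v)·entry i`
(`Matrix.transvection i j c = 1 + c • stdBasisMatrix i j`); the target row is `(1, 0, per_n)`, so register `2`
is the accumulator and a letter with `l.1 = 2` READS the accumulator back ("feedback").  Feedback-free words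
are words in the parabolic `P = ⟨E₀₁, E₁₀, E₀₂, E₁₂, constants⟩`: an exact `E₂`-skeleton on registers `0,1`
(Cohn's GE₂ world, Allender–Wang's exact width 2) plus one-way injections into register `2` — the same
one-way-flow shape as an ε-order-1 cascade.  The feedback count is the intrinsic rung parameter. -/

/-- Number of letters that read the accumulator register `2`. -/
def feedbackCount {n : ℕ} (w : List (Fin 3 × Fin 3 × ℂ × Option (Fin n × Fin n))) : ℕ :=
  (w.filter (fun l => decide (l.1 = 2))).length

/-- Feedback rung `k`: eventually no word within the quasi-polynomial budget and with at most `k`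
accumulator reads computes `E₀₂(per_n)`.  Each rung is implied by `WordLengthQP`; rung 0 = parabolic
(accumulator) words. -/
def FeedbackRung (k : ℕ) : Prop :=
  ∀ c : ℕ, ∃ n : ℕ, ∀ w : List (Fin 3 × Fin 3 × ℂ × Option (Fin n × Fin n)),
    w.length ≤ 2 ^ ((Nat.log 2 n + c) ^ c) → feedbackCount w ≤ k → (∀ l ∈ w, l.1 ≠ l.2.1) →
      (w.map (fun l => Matrix.transvection l.1 l.2.1
        (MvPolynomial.C l.2.2.1 * l.2.2.2.elim 1 MvPolynomial.X))).prod ≠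
        Matrix.transvection (0 : Fin 3) 2 (perPoly (Fin n) ℂ)

/-- Rungs are consequences of the crux (bookkeeping). -/
theorem feedbackRung_of_wordLengthQP (h : WordLengthQP) (k : ℕ) : FeedbackRung k := by
  sorry

/-- Rung 0 normal form (provable now): a feedback-free word writes `per_n` as `Σ_t ℓ_t · u_t` with `ℓ_t`
S-affine and `u_t` an entry of the row `(1,0)·(exact E₂-word prefix)` — at most `L` terms. -/
theorem feedbackRung_zero_normal_form {n : ℕ} (w : List (Fin 3 × Fin 3 × ℂ × Option (Fin n × Fin n)))
    (hw : ∀ l ∈ w, l.1 ≠ l.2.1) (h0 : feedbackCount w = 0)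
    (hprod : (w.map (fun l => Matrix.transvection l.1 l.2.1
        (MvPolynomial.C l.2.2.1 * l.2.2.2.elim 1 MvPolynomial.X))).prod =
        Matrix.transvection (0 : Fin 3) 2 (perPoly (Fin n) ℂ)) :
    ∃ (T : ℕ) (u ℓ : Fin T → MvPolynomial (Fin n × Fin n) ℂ),
      T ≤ w.length ∧ (∀ t, (ℓ t).totalDegree ≤ 1) ∧
      (∀ t, ∃ w₂ : List (Fin 2 × Fin 2 × ℂ × Option (Fin n × Fin n)), w₂.length ≤ w.length ∧
        (∀ l ∈ w₂, l.1 ≠ l.2.1) ∧ ∃ j : Fin 2,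
          u t = ((w₂.map (fun l => Matrix.transvection l.1 l.2.1
            (MvPolynomial.C l.2.2.1 * l.2.2.2.elim 1 MvPolynomial.X))).prod) 0 j) ∧
      perPoly (Fin n) ℂ = ∑ t, ℓ t * u t := by
  sorry

end

end Summit.ValiantsHypothesis.ValiantsHypothesis.Cruxes.WordLengthQP.EpsOrderLadder
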